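/-
Copyright (c) 2026 the pub-hodgecm-mathlib formalisation cell (harness21).  Prover seat hodgecm-mathlib-K2E2-p12 (g9), Track B «K2-LIT», h413 = `stmt-HodgeConjecture-24833`,
R90-TF section S8 «ContSpec-n½» (S8 dealer R90-CS-plan (g2); census `K2/K2E2-p12/g9/CENSUS-hMbd3.md` 84710b255d3f397f): the `U(2,1)` twin of ★ R90-C14-p01's
`K2E1EisensteinConstantTermIntertwinedBoundLevelU2` — the INTERTWINED PART of the Borel constant term of a LEVEL ∕ PAIR Eisenstein series of `U(2,1)_{L∕L⁺}` is BOUNDED HIGH IN THE CUSP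
(`Re z > 2`, `{T < H}`, `T > 0`): the tail letter `hMbd` of ★ `K2E1ChiEisensteinPairTubeSeedCuspOrthogonalCMThree` (this seat, ★ p863045).
-/
import Summits.HodgeConjecture.HodgeConjecture.Theorems.K2E1ChiEisensteinConstantTermCMThree   -- ★ (R90-C14-p01) CT unfolding `borelConstantTerm_eisensteinSeriesU_flatSectionU_cm_three` (section-generic); brings ★ `hfin_of_locallyUniformMajorant`, ★ CM₃ majorant, ★ (ν-2), ★ `IsChiSectionPair`
import Summits.HodgeConjecture.HodgeConjecture.Theorems.K2E1IntertwiningGrowthU3               -- ★ [D8]₃ `integral_borelHeight_weylLongU_mul_rpow_eq` (GK: `∫ H(w₀vg)^σ = c(σ)·H(g)^{2−σ}`), ★ `integrable_borelHeight_weylLongU_mul_rpow`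
import Literature.NumberTheory.Automorphic.UnitaryGroupIwasawaAdelic                           -- ★ `exists_mem_borelAdelic_mul_mem_standardMaximalCompactGL_cm_three` (Iwasawa `G = B·K` at the CM pair, `U(3)`)
import HarnessLib

/-!
# K2·E1 ∕ R90-TF S8 — `K2E1EisensteinConstantTermIntertwinedBoundLevelU3`: THE INTERTWINED PART `E_B(f_z) − f_z` OF THE CONSTANT TERM OF A LEVEL ∕ `(χ₁, χ₂)`-PAIR EISENSTEIN SERIES OF
# `U(2,1)_{L∕L⁺}` IS BOUNDED ON `{T < H}` (`Re z > 2`, `T > 0`) — the tail letter `hMbd` of the χ-pair tube seed ★ `K2E1ChiEisensteinPairTubeSeedCuspOrthogonalCMThree`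

Track B ∕ K2-LIT inside programme R90-TF, section S8 = continuous spectrum ∕ `n = ½` (base `R90-CS`), crux h413 = `stmt-HodgeConjecture-24833`, route of record `HCCMUnconditional`; cell
`hodgecm-mathlib`.  Prover seat `hodgecm-mathlib-K2E2-p12` (g9); consumer: this seat's ★ p863045 `Theorems/K2E1ChiEisensteinPairTubeSeedCuspOrthogonalCMThree.lean` (S8-R97 payer (a), the
χ-pair tube seed of the (R)-road ★ `R90S8ResGMidAtomOrthogonalCuspidalU3`), whose visible tail letter `hMbd` ([MoeglinWaldspurger1995, II.1.7]: «the intertwined part of `E_B` is bounded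
high in the cusp») is §1's conclusion token for token, and whose §3 binder `hMbd : ∀ z ∈ D, 2 < z.re → ∃ C, …` is §2's.  THEOREMS ONLY (no `def`, no `instance`, no notation, no named-fact
hypothesis, no `sorry`; default heartbeats); lane `--supports stmt-HodgeConjecture-24833 --as helper` (count-neutral).  Closes no socket.

THE MATHEMATICS ([MoeglinWaldspurger1995, II.1.6–II.1.7]; [Garrett2018, §2.8]; [GindikinKarpelevich1962]) — ★ `…LevelU2`'s proof with `2 ↦ 3`, `2ρ_B = 1 ↦ 2`.  For a continuous bounded
section `φ` (`‖φ‖ ≤ M`) of `U(J₃)(𝔸_{L⁺})`, left-invariant under the Heisenberg radical `N(𝔸)` and under `B(L⁺)`, and `Re z > 2`, the Borel constant term of `E(f_z)`, `f_z = φ·H^z`, unfolds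
along the (rank-one, two-celled) Bruhat decomposition as `E_B(f_z)(g) = f_z(g) + (ν𝓕)⁻¹·∫_{N(𝔸)} f_z(w₀ v g) dν(v)` (★ `K2E1ChiEisensteinConstantTermCMThree.borelConstantTerm_eisensteinSeriesU_flatSectionU_cm_three`,
section-generic).  The big-cell integral is dominated termwise, `|f_z(w₀ v g)| ≤ M·H(w₀ v g)^{Re z}`, and the spherical standard intertwining integral is computed by Gindikin–Karpelevich ∕
Iwasawa–Levi: `∫_{N(𝔸)} H(w₀ v g)^σ dν(v) = c(σ)·H(g)^{2−σ}`, `c(σ) = ∫_{N(𝔸)} H(w₀ v)^σ dν(v) < ∞` for `σ = Re z > 2` (★ [D8]₃ `K2E1IntertwiningGrowthU3.integral_borelHeight_weylLongU_mul_rpow_eq`,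
finiteness ★ `integrable_borelHeight_weylLongU_mul_rpow` from the Godement finiteness of the standard section, ★ `hfin_of_locallyUniformMajorant` ∘ ★ `exists_locallyUniform_majorant_flatSectionU_cm_three`).
Hence `‖E_B(f_z)(g) − f_z(g)‖ ≤ (ν𝓕)⁻¹·M·c(Re z)·H(g)^{2−Re z} ≤ (ν𝓕)⁻¹·M·c(Re z)·T^{2−Re z}` whenever `T < H(g)`, because `2 − Re z < 0` and `T > 0` (Mathlib `Real.rpow_le_rpow_of_nonpos`).
The hypothesis `0 < T` is NECESSARY: at the spherical vector the intertwined part is `(ν𝓕)⁻¹·c(z)φ₀·H(g)^{2−z}`, unbounded as `H(g) → 0`.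
* §1 **`exists_bound_norm_borelConstantTerm_sub_flatSectionU_cm_three`** — `∃ C, ∀ g, T < H(g) → ‖E(f_z)_B(g) − f_z(g)‖ ≤ C` (binders = ★ CT unfolding's `ν h𝓕N h𝓕c hφc hφM hφN hφB hz`
  verbatim, then `{T : ℝ≥0} (hT : 0 < T)`); **`…_pair_cm_three`** — the same for a continuous bounded `(χ₁, χ₂)`-pair section (★ `IsChiSectionPair`, `χ₂` automorphic).
* §2 **`hMbd_level_cm_three`**, **`hMbd_pair_cm_three`** — the tube seed's §3 binder shape `∀ z ∈ D, 2 < z.re → ∃ C, ∀ g, T < H g → ‖…‖ ≤ C` for any `D` and `1 ≤ T`.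
HONEST LABEL: HC_CM is proved only modulo the 7 printed citations (2 remaining named inputs: hLiu418 = `stmt-HodgeConjecture-24832`, h413 = `stmt-HodgeConjecture-24833`) until rung 0
closes; this file asserts no named fact and closes no socket; it is unconditional (no letters).
References: [MoeglinWaldspurger1995] C. Mœglin, J.-L. Waldspurger, *Spectral Decomposition and Eisenstein Series* (1995), II.1.6–II.1.7 · [Garrett2018] P. Garrett, *Modern Analysis of
Automorphic Forms by Example* 1 (2018), §2.8 · [Rogawski1990] §2.2, §13.9 p. 229 · [Godement1964] §1.1.
-/

set_option autoImplicit false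
set_option linter.dupNamespace false  -- the mandated namespace repeats the single-problem summit's segment (`HodgeConjecture.HodgeConjecture`)

noncomputable section

open MeasureTheory Measure NumberField IsDedekindDomain Set Filter
open scoped ENNReal NNReal Topology
open Literature.NumberTheory.Automorphic Literature.NumberTheory.Automorphic.UnitaryGroup AdelicGroupData
open Literature.NumberTheory.Automorphic.Arthur2013.Leaves.TECR
open Literature.NumberTheory.GaloisRepresentations (HeckeCharacter)
open Summit.HodgeConjecture.HodgeConjecture.Cruxes.H413.K2E1BorelEisensteinU
open Summit.HodgeConjecture.HodgeConjecture.Cruxes.H413.K2E1CharacterEisensteinU3PairDefs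
open Summit.HodgeConjecture.HodgeConjecture.Cruxes.H413.K2E1EisensteinAnalyticBinders (hfin_of_locallyUniformMajorant)
open Summit.HodgeConjecture.HodgeConjecture.Cruxes.H413.K2E1BorelEisensteinGodementCMThree (exists_locallyUniform_majorant_flatSectionU_cm_three)
open Summit.HodgeConjecture.HodgeConjecture.Cruxes.H413.K2E1HeisenbergHaarU3 (isInvInvariant_of_isHaarMeasure_adelicUnipotent_three)
open Summit.HodgeConjecture.HodgeConjecture.Cruxes.H413.K2E1BorelCosetsDictionary (forall_arithmeticBorel_iff)
open Summit.HodgeConjecture.HodgeConjecture.Cruxes.H413.K2E1ChiEisensteinConstantTermCMThree (borelConstantTerm_eisensteinSeriesU_flatSectionU_cm_three)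
open Summit.HodgeConjecture.HodgeConjecture.Cruxes.H413.K2E1IntertwiningGrowthU3 (integral_borelHeight_weylLongU_mul_rpow_eq integrable_borelHeight_weylLongU_mul_rpow)

namespace Summit.HodgeConjecture.HodgeConjecture.Cruxes.H413.K2E1EisensteinConstantTermIntertwinedBoundLevelU3

variable (L : Type) [Field L] [NumberField L] [IsCMField L]
variable [MeasurableSpace (quasiSplit (↥(maximalRealSubfield L)) L (IsCMField.complexConj L) 3).Adelic] [BorelSpace (quasiSplit (↥(maximalRealSubfield L)) L (IsCMField.complexConj L) 3).Adelic]

/-! ## §1 The bound on `{T < H}` for one `z` with `Re z > 2` -/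

/-- **THE INTERTWINED PART OF THE CONSTANT TERM OF A LEVEL EISENSTEIN SERIES OF `U(2,1)_{L∕L⁺}` IS BOUNDED HIGH IN THE CUSP** (the letter `hMbd` of the χ-pair tube seed): for a Haar
measure `ν` of the Heisenberg radical `N(𝔸_{L⁺})`, a fundamental domain `𝓕` of `N(L⁺)` with compact closure, a CONTINUOUS BOUNDED section `φ` (`‖φ‖ ≤ M`) left-invariant under `N(𝔸_{L⁺})`
and `B(L⁺)`, `2 < Re z` and `0 < T`: there is `C` with `‖E(f_z)_B(g) − f_z(g)‖ ≤ C` for every `g` with `T < H(g)` (`f_z = φ·H^z`).  Proof: Bruhat unfolding ★ `E_B(f_z) = f_z +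
(ν𝓕)⁻¹·∫_{N(𝔸)} f_z(w₀ v ·) dν`, `|f_z(w₀vg)| ≤ M·H(w₀vg)^{Re z}`, Gindikin–Karpelevich ★ `∫ H(w₀vg)^σ dν = c(σ)H(g)^{2−σ}` (`c(σ) < ∞` ★), and `H(g)^{2−Re z} ≤ T^{2−Re z}`; `C =
(ν𝓕)⁻¹·M·c(Re z)·T^{2−Re z}`.  (`0 < T` is necessary: the intertwined part of the spherical series is `∝ H(g)^{2−z}`, unbounded as `H(g) → 0`.) [cite: MoeglinWaldspurger1995, II.1.6–II.1.7] [cite: Garrett2018, §2.8] -/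
theorem exists_bound_norm_borelConstantTerm_sub_flatSectionU_cm_three (ν : Measure ↥(adelicUnipotent (↥(maximalRealSubfield L)) L (IsCMField.complexConj L) 3)) [ν.IsHaarMeasure]
    {𝓕 : Set ↥(adelicUnipotent (↥(maximalRealSubfield L)) L (IsCMField.complexConj L) 3)} (h𝓕N : IsFundamentalDomain ↥(rationalUnipotent (↥(maximalRealSubfield L)) L (IsCMField.complexConj L) 3) 𝓕 ν) (h𝓕c : IsCompact (closure 𝓕))
    {φ : (quasiSplit (↥(maximalRealSubfield L)) L (IsCMField.complexConj L) 3).Adelic → ℂ} (hφc : Continuous φ) {M : ℝ} (hφM : ∀ x, ‖φ x‖ ≤ M)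
    (hφN : ∀ (n : ↥(adelicUnipotent (↥(maximalRealSubfield L)) L (IsCMField.complexConj L) 3)) (y : (quasiSplit (↥(maximalRealSubfield L)) L (IsCMField.complexConj L) 3).Adelic),
      φ ((n : (quasiSplit (↥(maximalRealSubfield L)) L (IsCMField.complexConj L) 3).Adelic) * y) = φ y)
    (hφB : ∀ b ∈ borelU ((IsCMField.complexConj L : L ≃ₐ[↥(maximalRealSubfield L)] L) : L →+* L) ((StdForm.antidiagonal 3).over L), ∀ x : (quasiSplit (↥(maximalRealSubfield L)) L (IsCMField.complexConj L) 3).Adelic,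
      φ ((quasiSplit (↥(maximalRealSubfield L)) L (IsCMField.complexConj L) 3).toAdelic b * x) = φ x)
    {z : ℂ} (hz : 2 < z.re) {T : ℝ≥0} (hT : 0 < T) :
    ∃ C : ℝ, ∀ g : (quasiSplit (↥(maximalRealSubfield L)) L (IsCMField.complexConj L) 3).Adelic, T < borelHeight g →
      ‖borelConstantTerm ν 𝓕 (eisensteinSeriesU (flatSectionU φ z)) g - flatSectionU φ z g‖ ≤ C := by
  haveI := t2Space_adeleRing_of_numberField L
  haveI := locallyCompactSpace_adeleRing' L
  haveI : T2Space (quasiSplit (↥(maximalRealSubfield L)) L (IsCMField.complexConj L) 3).Adelic := inferInstanceAs (T2Space (adelic (↥(maximalRealSubfield L)) L (IsCMField.complexConj L) 3 ((StdForm.antidiagonal 3).over L)))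
  have hc : IsCMField.complexConj L * IsCMField.complexConj L = 1 := AlgEquiv.ext fun x => IsCMField.complexConj_apply_apply L x
  have hc1 : IsCMField.complexConj L ≠ 1 := IsCMField.complexConj_ne_one L
  haveI : ν.IsInvInvariant := isInvInvariant_of_isHaarMeasure_adelicUnipotent_three hc ν
  have hBK := exists_mem_borelAdelic_mul_mem_standardMaximalCompactGL_cm_three L
  have hMnn : 0 ≤ M := (norm_nonneg _).trans (hφM 1)
  -- `c(Re z) = ∫_{N(𝔸)} H(w₀ v)^{Re z} dν(v) ≥ 0`
  have hcnn : 0 ≤ ∫ v : ↥(adelicUnipotent (↥(maximalRealSubfield L)) L (IsCMField.complexConj L) 3),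
      (borelHeight ((quasiSplit (↥(maximalRealSubfield L)) L (IsCMField.complexConj L) 3).toAdelic (weylLongU ((IsCMField.complexConj L : L ≃ₐ[↥(maximalRealSubfield L)] L) : L →+* L) (rfl : (StdForm.antidiagonal 3).over L = (StdForm.antidiagonal 3).over L)) *
        (v : (quasiSplit (↥(maximalRealSubfield L)) L (IsCMField.complexConj L) 3).Adelic)) : ℝ) ^ z.re ∂ν :=
    integral_nonneg fun v => Real.rpow_nonneg (NNReal.coe_nonneg _) _
  refine ⟨(ν 𝓕).toReal⁻¹ * (M * ((∫ v : ↥(adelicUnipotent (↥(maximalRealSubfield L)) L (IsCMField.complexConj L) 3),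
      (borelHeight ((quasiSplit (↥(maximalRealSubfield L)) L (IsCMField.complexConj L) 3).toAdelic (weylLongU ((IsCMField.complexConj L : L ≃ₐ[↥(maximalRealSubfield L)] L) : L →+* L) (rfl : (StdForm.antidiagonal 3).over L = (StdForm.antidiagonal 3).over L)) *
        (v : (quasiSplit (↥(maximalRealSubfield L)) L (IsCMField.complexConj L) 3).Adelic)) : ℝ) ^ z.re ∂ν) * (T : ℝ) ^ (2 - z.re))), fun g hTg => ?_⟩
  have hTpos : (0 : ℝ) < (T : ℝ) := by exact_mod_cast hT
  have hTle : (T : ℝ) ≤ (borelHeight g : ℝ) := by exact_mod_cast hTg.le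
  -- Godement finiteness of the standard section `H^z` at `g`, hence `v ↦ H(w₀ v g)^{Re z} ∈ L¹(ν)`
  have hfB1 : ∀ b ∈ borelU ((IsCMField.complexConj L : L ≃ₐ[↥(maximalRealSubfield L)] L) : L →+* L) ((StdForm.antidiagonal 3).over L), ∀ x : (quasiSplit (↥(maximalRealSubfield L)) L (IsCMField.complexConj L) 3).Adelic,
      flatSectionU (fun _ : (quasiSplit (↥(maximalRealSubfield L)) L (IsCMField.complexConj L) 3).Adelic => (1 : ℂ)) z ((quasiSplit (↥(maximalRealSubfield L)) L (IsCMField.complexConj L) 3).toAdelic b * x) =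
        flatSectionU (fun _ : (quasiSplit (↥(maximalRealSubfield L)) L (IsCMField.complexConj L) 3).Adelic => (1 : ℂ)) z x :=
    forall_arithmeticBorel_iff.1 fun b hb x => by rw [flatSectionU_apply, flatSectionU_apply, K2E1TruncatedEisensteinExplicit.borelHeight_arithmeticBorel_mul hb]
  have hfin := hfin_of_locallyUniformMajorant ν hfB1 (fun q => (continuous_flatSectionU continuous_const z).comp (continuous_const.mul continuous_id))
    (exists_locallyUniform_majorant_flatSectionU_cm_three L hz (φ := fun _ : (quasiSplit (↥(maximalRealSubfield L)) L (IsCMField.complexConj L) 3).Adelic => (1 : ℂ)) (M := ‖(1 : ℂ)‖) (fun x => le_rfl)) h𝓕c g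
  have hI := integrable_borelHeight_weylLongU_mul_rpow ν h𝓕N z g hfin
  -- `|f_z(w₀ v g)| ≤ M · H(w₀ v g)^{Re z}`
  have hle : ∀ v : ↥(adelicUnipotent (↥(maximalRealSubfield L)) L (IsCMField.complexConj L) 3),
      ‖flatSectionU φ z ((quasiSplit (↥(maximalRealSubfield L)) L (IsCMField.complexConj L) 3).toAdelic (weylLongU ((IsCMField.complexConj L : L ≃ₐ[↥(maximalRealSubfield L)] L) : L →+* L) (rfl : (StdForm.antidiagonal 3).over L = (StdForm.antidiagonal 3).over L)) *
        ((v : (quasiSplit (↥(maximalRealSubfield L)) L (IsCMField.complexConj L) 3).Adelic) * g))‖ ≤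
        M * (borelHeight ((quasiSplit (↥(maximalRealSubfield L)) L (IsCMField.complexConj L) 3).toAdelic (weylLongU ((IsCMField.complexConj L : L ≃ₐ[↥(maximalRealSubfield L)] L) : L →+* L) (rfl : (StdForm.antidiagonal 3).over L = (StdForm.antidiagonal 3).over L)) *
          ((v : (quasiSplit (↥(maximalRealSubfield L)) L (IsCMField.complexConj L) 3).Adelic) * g)) : ℝ) ^ z.re := fun v => by
    have hp : (0 : ℝ) < (borelHeight ((quasiSplit (↥(maximalRealSubfield L)) L (IsCMField.complexConj L) 3).toAdelic (weylLongU ((IsCMField.complexConj L : L ≃ₐ[↥(maximalRealSubfield L)] L) : L →+* L) (rfl : (StdForm.antidiagonal 3).over L = (StdForm.antidiagonal 3).over L)) *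
        ((v : (quasiSplit (↥(maximalRealSubfield L)) L (IsCMField.complexConj L) 3).Adelic) * g)) : ℝ) := by exact_mod_cast borelHeight_pos _
    rw [flatSectionU_apply, norm_mul, Complex.norm_cpow_eq_rpow_re_of_pos hp]
    exact mul_le_mul_of_nonneg_right (hφM _) (Real.rpow_nonneg hp.le _)
  -- `‖∫ f_z(w₀ v g) dν‖ ≤ M · c(Re z) · H(g)^{2 − Re z}` (Gindikin–Karpelevich ★)
  have hM : ‖∫ v : ↥(adelicUnipotent (↥(maximalRealSubfield L)) L (IsCMField.complexConj L) 3),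
      flatSectionU φ z ((quasiSplit (↥(maximalRealSubfield L)) L (IsCMField.complexConj L) 3).toAdelic (weylLongU ((IsCMField.complexConj L : L ≃ₐ[↥(maximalRealSubfield L)] L) : L →+* L) (rfl : (StdForm.antidiagonal 3).over L = (StdForm.antidiagonal 3).over L)) *
        ((v : (quasiSplit (↥(maximalRealSubfield L)) L (IsCMField.complexConj L) 3).Adelic) * g)) ∂ν‖ ≤
      M * ((∫ v : ↥(adelicUnipotent (↥(maximalRealSubfield L)) L (IsCMField.complexConj L) 3),
        (borelHeight ((quasiSplit (↥(maximalRealSubfield L)) L (IsCMField.complexConj L) 3).toAdelic (weylLongU ((IsCMField.complexConj L : L ≃ₐ[↥(maximalRealSubfield L)] L) : L →+* L) (rfl : (StdForm.antidiagonal 3).over L = (StdForm.antidiagonal 3).over L)) *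
          (v : (quasiSplit (↥(maximalRealSubfield L)) L (IsCMField.complexConj L) 3).Adelic)) : ℝ) ^ z.re ∂ν) * (borelHeight g : ℝ) ^ (2 - z.re)) := by
    rw [← integral_borelHeight_weylLongU_mul_rpow_eq hc hc1 ν hBK z.re g, ← integral_const_mul]
    exact norm_integral_le_of_norm_le (hI.const_mul M) (Eventually.of_forall hle)
  -- the Bruhat-unfolded constant term ★ and the height bound `H(g)^{2−Re z} ≤ T^{2−Re z}`
  rw [borelConstantTerm_eisensteinSeriesU_flatSectionU_cm_three L ν h𝓕N h𝓕c hφc hφM hφN hφB hz g, add_sub_cancel_left, norm_smul, Real.norm_eq_abs,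
    abs_of_nonneg (inv_nonneg.2 ENNReal.toReal_nonneg)]
  simp_rw [mul_assoc ((quasiSplit (↥(maximalRealSubfield L)) L (IsCMField.complexConj L) 3).toAdelic (weylLongU ((IsCMField.complexConj L : L ≃ₐ[↥(maximalRealSubfield L)] L) : L →+* L) (rfl : (StdForm.antidiagonal 3).over L = (StdForm.antidiagonal 3).over L)))]
  refine mul_le_mul_of_nonneg_left (hM.trans ?_) (inv_nonneg.2 ENNReal.toReal_nonneg)
  refine mul_le_mul_of_nonneg_left (mul_le_mul_of_nonneg_left ?_ hcnn) hMnn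
  exact Real.rpow_le_rpow_of_nonpos hTpos hTle (by linarith)

/-- **THE SAME FOR A `(χ₁, χ₂)`-PAIR SECTION** `φ_ξ` (★ `IsChiSectionPair χ₁ χ₂ φ_ξ`, `χ₂` automorphic; continuous, `‖φ_ξ‖ ≤ M`): `∃ C, ∀ g, T < H(g) → ‖E(f_z)_B(g) − f_z(g)‖ ≤ C` for `2 < Re z`,
`0 < T` — §1 with the invariances ★ `IsChiSectionPair.unipotent_mul` ∕ ★ `IsChiSectionPair.toAdelic_mul`. [cite: MoeglinWaldspurger1995, II.1.7] [cite: Rogawski1990, §13.9 p. 229] -/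
theorem exists_bound_norm_borelConstantTerm_sub_flatSectionU_pair_cm_three (ν : Measure ↥(adelicUnipotent (↥(maximalRealSubfield L)) L (IsCMField.complexConj L) 3)) [ν.IsHaarMeasure]
    {𝓕 : Set ↥(adelicUnipotent (↥(maximalRealSubfield L)) L (IsCMField.complexConj L) 3)} (h𝓕N : IsFundamentalDomain ↥(rationalUnipotent (↥(maximalRealSubfield L)) L (IsCMField.complexConj L) 3) 𝓕 ν) (h𝓕c : IsCompact (closure 𝓕))
    {χ₁ : HeckeCharacter L} {χ₂ : ↥(TorusDict.torus (IsCMField.complexConj L)) →ₜ* ℂˣ} (hχ₂ : TorusDict.IsAutomorphic (IsCMField.complexConj L) χ₂)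
    {φξ : (quasiSplit (↥(maximalRealSubfield L)) L (IsCMField.complexConj L) 3).Adelic → ℂ} (hφξ : IsChiSectionPair χ₁ χ₂ φξ) (hφc : Continuous φξ) {M : ℝ} (hφM : ∀ x, ‖φξ x‖ ≤ M)
    {z : ℂ} (hz : 2 < z.re) {T : ℝ≥0} (hT : 0 < T) :
    ∃ C : ℝ, ∀ g : (quasiSplit (↥(maximalRealSubfield L)) L (IsCMField.complexConj L) 3).Adelic, T < borelHeight g →
      ‖borelConstantTerm ν 𝓕 (eisensteinSeriesU (flatSectionU φξ z)) g - flatSectionU φξ z g‖ ≤ C :=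
  exists_bound_norm_borelConstantTerm_sub_flatSectionU_cm_three L ν h𝓕N h𝓕c hφc hφM hφξ.unipotent_mul (hφξ.toAdelic_mul hχ₂) hz hT

/-! ## §2 The tube seed's §3 binder shape: `∀ z ∈ D, 2 < z.re → ∃ C, …` above the floor `T ≥ 1` -/

/-- **`hMbd` IN THE TUBE SEED'S SHAPE, LEVEL SECTION**: for ANY `D ⊆ ℂ` and `1 ≤ T`, `∀ z ∈ D, 2 < z.re → ∃ C, ∀ g, T < H(g) → ‖E(f_z)_B(g) − f_z(g)‖ ≤ C` — the binder `hMbd` of ★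
`K2E1ChiEisensteinPairTubeSeedCuspOrthogonalCMThree.tubeSeed_level_cm_three_of_letters` token for token (§1 at each tube point; `0 < 1 ≤ T`). [cite: MoeglinWaldspurger1995, II.1.7] -/
theorem hMbd_level_cm_three (ν : Measure ↥(adelicUnipotent (↥(maximalRealSubfield L)) L (IsCMField.complexConj L) 3)) [ν.IsHaarMeasure]
    {𝓕 : Set ↥(adelicUnipotent (↥(maximalRealSubfield L)) L (IsCMField.complexConj L) 3)} (h𝓕N : IsFundamentalDomain ↥(rationalUnipotent (↥(maximalRealSubfield L)) L (IsCMField.complexConj L) 3) 𝓕 ν) (h𝓕c : IsCompact (closure 𝓕))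
    {φ : (quasiSplit (↥(maximalRealSubfield L)) L (IsCMField.complexConj L) 3).Adelic → ℂ} (hφc : Continuous φ) {M : ℝ} (hφM : ∀ x, ‖φ x‖ ≤ M)
    (hφN : ∀ (n : ↥(adelicUnipotent (↥(maximalRealSubfield L)) L (IsCMField.complexConj L) 3)) (y : (quasiSplit (↥(maximalRealSubfield L)) L (IsCMField.complexConj L) 3).Adelic),
      φ ((n : (quasiSplit (↥(maximalRealSubfield L)) L (IsCMField.complexConj L) 3).Adelic) * y) = φ y)
    (hφB : ∀ b ∈ borelU ((IsCMField.complexConj L : L ≃ₐ[↥(maximalRealSubfield L)] L) : L →+* L) ((StdForm.antidiagonal 3).over L), ∀ x : (quasiSplit (↥(maximalRealSubfield L)) L (IsCMField.complexConj L) 3).Adelic,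
      φ ((quasiSplit (↥(maximalRealSubfield L)) L (IsCMField.complexConj L) 3).toAdelic b * x) = φ x)
    {T : ℝ≥0} (hT : 1 ≤ T) (D : Set ℂ) :
    ∀ z ∈ D, 2 < z.re → ∃ C : ℝ, ∀ g : (quasiSplit (↥(maximalRealSubfield L)) L (IsCMField.complexConj L) 3).Adelic, T < borelHeight g →
      ‖borelConstantTerm ν 𝓕 (eisensteinSeriesU (flatSectionU φ z)) g - flatSectionU φ z g‖ ≤ C :=
  fun _ _ hz => exists_bound_norm_borelConstantTerm_sub_flatSectionU_cm_three L ν h𝓕N h𝓕c hφc hφM hφN hφB hz (zero_lt_one.trans_le hT)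

/-- **`hMbd` IN THE TUBE SEED'S SHAPE, `(χ₁, χ₂)`-PAIR SECTION** (`χ₂` automorphic): for ANY `D ⊆ ℂ` and `1 ≤ T`, `∀ z ∈ D, 2 < z.re → ∃ C, ∀ g, T < H(g) → ‖E(f_z)_B(g) − f_z(g)‖ ≤ C` — the
binder `hMbd` of ★ `K2E1ChiEisensteinPairTubeSeedCuspOrthogonalCMThree.tubeSeed_pair_cm_three_of_letters` token for token. [cite: MoeglinWaldspurger1995, II.1.7] [cite: Rogawski1990, §13.9 p. 229] -/
theorem hMbd_pair_cm_three (ν : Measure ↥(adelicUnipotent (↥(maximalRealSubfield L)) L (IsCMField.complexConj L) 3)) [ν.IsHaarMeasure]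
    {𝓕 : Set ↥(adelicUnipotent (↥(maximalRealSubfield L)) L (IsCMField.complexConj L) 3)} (h𝓕N : IsFundamentalDomain ↥(rationalUnipotent (↥(maximalRealSubfield L)) L (IsCMField.complexConj L) 3) 𝓕 ν) (h𝓕c : IsCompact (closure 𝓕))
    {χ₁ : HeckeCharacter L} {χ₂ : ↥(TorusDict.torus (IsCMField.complexConj L)) →ₜ* ℂˣ} (hχ₂ : TorusDict.IsAutomorphic (IsCMField.complexConj L) χ₂)
    {φξ : (quasiSplit (↥(maximalRealSubfield L)) L (IsCMField.complexConj L) 3).Adelic → ℂ} (hφξ : IsChiSectionPair χ₁ χ₂ φξ) (hφc : Continuous φξ) {M : ℝ} (hφM : ∀ x, ‖φξ x‖ ≤ M)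
    {T : ℝ≥0} (hT : 1 ≤ T) (D : Set ℂ) :
    ∀ z ∈ D, 2 < z.re → ∃ C : ℝ, ∀ g : (quasiSplit (↥(maximalRealSubfield L)) L (IsCMField.complexConj L) 3).Adelic, T < borelHeight g →
      ‖borelConstantTerm ν 𝓕 (eisensteinSeriesU (flatSectionU φξ z)) g - flatSectionU φξ z g‖ ≤ C :=
  fun _ _ hz => exists_bound_norm_borelConstantTerm_sub_flatSectionU_pair_cm_three L ν h𝓕N h𝓕c hχ₂ hφξ hφc hφM hz (zero_lt_one.trans_le hT)

end Summit.HodgeConjecture.HodgeConjecture.Cruxes.H413.K2E1EisensteinConstantTermIntertwinedBoundLevelU3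

end
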